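import Summits.ResolutionOfSingularities.ResolutionOfSingularities.Theorems.FactorCutCells2
import Summits.ResolutionOfSingularities.ResolutionOfSingularities.Theorems.WeightedInvariantLocalWeightedDropTrackCForward
import Literature.AlgebraicGeometry.Resolution.BlowupRestrictOpen
import Literature.AlgebraicGeometry.Resolution.MarkedIdealsRestrict
import Literature.AlgebraicGeometry.Resolution.PermissibleBlowup
import Literature.AlgebraicGeometry.Resolution.PrimeDivisorIdeals
import Literature.AlgebraicGeometry.Resolution.DivisorialPart
import Literature.AlgebraicGeometry.Resolution.StalkIdealGenerization
import Literature.AlgebraicGeometry.Resolution.AlterationsProofs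
import Literature.AlgebraicGeometry.Resolution.Hironaka2005NumericalExponentProof
import HarnessLib

/-!
# RestrictCutKernels — decomp-res node «RestrictCut» (lens-4 g34, critic row 194 CLEARED (NP-R) DECIDED +1 · MAP 0),
tree file 1/4 of the node

Content VERBATIM from the decomp-res lens-4 g34 node `HOME/decomp-res-lens-4/g34/RestrictCut.lean` (pin bc9b1075,
596 l; HOME = run/shared/lean/pub/decomp-res): NO carry — the node imports the LANDED tree only (g33 «FactorCut» =
`Theorems/FactorCutKernels` · `FactorCutKernels2` · `FactorCutCells` · `FactorCutCells2` · `MaxContactCutFactorCut`,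
g32 `MaxContactCutTauChainCut`, eight Literature files); every declaration is new, same namespace
`…Theorems.HugValuationCut`.  Farm (node, lens + critic runs): rc 0 · 0 err · 0 warn · 0 sorry · axioms std; Probe
rc 0 (23 must-fail sorries = batteries).  Critic: CRITIC-LEDGER row 194 CLEARED (NP-R) DECIDED +1 · MAP 0 (lane
(NP-R) of row 191: the RESTRICTION KERNEL (R) of forced towers — the genuine restriction functor `towerRestrict`,
the PERSISTENCE kernel, Step A / Step B, and the WHOLE-KIND KILL `noTower_nonDivisorial_threefold`; cells D₃ EMPTY
in kernel / D₄ expected habitat; exact hypothesis-free re-locations; (O2) vacated).  Landing orders = the critic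
rider INBOX :1135 (= the lens LANDING NOTE INBOX :1128 and the three `══ FILE` markers of the node): FILE 1
`RestrictCutKernels` = §105–§108 (cone-free; imports `FactorCutCells2` + the eight Literature files + HarnessLib;
the `open …Theses` line dropped as for `FactorCutKernels`), FILE 2 `RestrictCutCells` = §109 (cone-free; imports
FILE 1), FILE 3 `MaxContactCutRestrictCut` = §110 (Theses cone; imports FILE 2 + `MaxContactCutFactorCut` ⊇
`MaxContactCutTauChainCut`); each VERBATIM, `--kind proof --supports stmt-ResolutionOfSingularities-28338`; decl
names final.  The new `def … : Prop` / `structure` declarations are letters / cells of THIS node — none is a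
vendored fact.  Aside bookkeeping (rider: one switch per generation; the g33 switch to `NoWildOccultMixedTowers` =
item 28368 WAS made at route rev 59): the g34 located residual `NoWildOccultDivisorialOrNonThreefoldMixedTowers`
(home `RestrictCutCells`) SUPERSEDES item 28368 hypothesis-free (`noWildOccultMixedTowers_iff_g34`); for 28338:
`noWildContactFreeOffLocusTowers_iff_g34 (h71) (h640)`.

The lens header, verbatim:

> # RestrictCut — decomp-res-lens-4 g34 node «RestrictCut» (lane (NP-R) of CRITIC row 191: the RESTRICTION KERNEL (R) of forced
> towers — the genuine restriction functor `towerRestrict` with all letters inherited, the PERSISTENCE KERNEL «the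
exceptional divisor is
> never a component; divisorial components of `V(𝓘_{i+1})` are strict transforms», and the WHOLE-KIND KILL
> `noTower_nonDivisorial_threefold` — every `p`, every field, EVERY class `P`, every weight `n ≥ 1`: NO forced
threefold tower whose
> marked stalk ideals admit no divisorial factor; see the module docstrings of §105–§110 and
HOME/decomp-res-lens-4/g34/NODE-g34.md).
>
> NO CARRY: g33 «FactorCut» is in the tree (`Theorems/FactorCutKernels.lean`, `FactorCutKernels2.lean`, `FactorCutCells.lean`,
> `FactorCutCells2.lean`, landed 2026-08-31T07:07–07:17Z) and is IMPORTED; this file imports the landed tree only.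
Landing form (three
> tree files, in this order, cut at the `══ FILE` markers): FILE 1 `Theorems/RestrictCutKernels.lean` = §105–§108
(cone-free: imports
> `FactorCutCells2` + the eight Literature files), FILE 2 `Theorems/RestrictCutCells.lean` = §109 (cone-free:
imports FILE 1), FILE 3
> `Theorems/MaxContactCutRestrictCut.lean` = §110 (Theses cone: imports FILE 2 + `MaxContactCutTauChainCut`).

## This file

§105 (g34 · NEW · KERNEL) THE RESTRICTION FUNCTOR OF FORCED TOWERS (`section Restrict`: `towerRestrict` — a genuine
`ForcedTower` functor to a chain of root opens, stages / comap ideals / centres / `π ∣_ U_i`, every letter inherited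
and proved); §106 (NEW · KERNEL) THE PERSISTENCE KERNEL «the exceptional divisor is never a component; divisorial
components of `V(𝓘_{i+1})` are strict transforms» (`section Persistence`, via
`IsBlowup.one_lt_coheight_of_mem_support_controlledTransform`); §107 (NEW · KERNEL) STEP A — a divisorial component
through the marked point is a divisorial FACTOR (UFD stalk ⇒ principal prime-divisor factor ⇒ `DivisorialTower`) and
STEP B — finitely many divisorial points, an isolating root open (`section DivisorialSteps`); §108 (NEW · KERNEL)
THE WHOLE-KIND KILL `noTower_nonDivisorial_threefold` — every `p`, every field, EVERY class `P`, every weight `n ≥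
1`: no forced threefold tower whose marked stalk ideals admit no divisorial factor (`section NonDivisorialLaw`: Step
B + restriction + persistence + Law C `noTower_threefold_curveLike` by name; priced name
`noTowerWild_occultNonDivisorial_threefold`) — continued in `RestrictCutKernels2`… where the 400-line cap cuts.
(This first part carries: `rootOpens`, `rootOpens_zero`, `rootOpens_succ`, `pt_mem_rootOpens`,
`mem_support_comap_iff`, `towerRestrict`, `towerRestrict_St`, `towerRestrict_D`, `towerRestrict_pt_val`,
`towerRestrict_centre`, `towerRestrict_π`, `mem_support_towerRestrict_ideal_iff`, `towerRestrict_isBase`,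
`towerRestrict_isDatum`, `towerRestrict_boundary`, `towerRestrict_ringKrullDim_stalk`,
`towerRestrict_threefoldTower`, `curveLikeTower_of_root`, `exists_nat_idealOrder_eq_of_stalkIdeal_le`.)

[WRITER NOTE (decomp-res writer g12): file split only (tree files ≤ 400 lines); namespace, sections, section
variables / universes / opens and every declaration exactly as in the lens (the node's file-level
dupNamespace-linter line is dropped — the library sets it; the `open …Theses` line lives only in the Theses-cone
file `MaxContactCutRestrictCut`); ONE dedup token change in `RestrictCutKernels`: the lens's 3-line folklore lemma
`stalkIdeal_bot_eq` restates the LANDED `TrackC.stalkIdeal_bot`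
(`Theorems/WeightedInvariantLocalWeightedDropTrackCForward`, landed the same morning by another hand; pre-flight
`dedup.landed`) — the copy is DELETED, that module imported, and its one use in §107 cites `TrackC.stalkIdeal_bot`.]

(Sources: Hironaka1964 Ch. III; Giraud1975; Kollar2007 3.58–3.60; CossartJannsenSaito2020 Thm. 6.40, Ch. 8;
Hauser2010Kangaroo; HauserPerlega2019 §2; CossartPiltant2008 §2; deJong1996 (alterations); Hironaka2005 (numerical
exponent, three key theorems); EGAIV4 §16, §21 (divisors); Matsumura1987 §20 (UFD), §28; StacksProject 0804 / 0BIQ /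
031I / 0AFT.)
-/

noncomputable section

open CategoryTheory AlgebraicGeometry IsLocalRing TopologicalSpace
open Literature.AlgebraicGeometry.Resolution
open Summit.ResolutionOfSingularities.ResolutionOfSingularities.Theorems
open WeakOrderReduction ForcedTowerClasses DivergentTowerClasses MonomialTowerClasses
open HugDimensionClasses HugDimensionKernels SurfaceShadowClasses SurfaceShadowKernels
open NearPointCut (SingularClass)
open Scheme.IdealSheafData (vanishingIdeal)
open scoped BigOperators

namespace Summit.ResolutionOfSingularities.ResolutionOfSingularities.Theorems.HugValuationCut

section Restrict

variable {k : Type} [Field k]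

/-! ## ══ FILE 1/3 `Theorems/RestrictCutKernels.lean` (§105–§108; cone-free) ══ -/

/-! ## §105 (g34 · NEW · KERNEL) THE RESTRICTION FUNCTOR OF FORCED TOWERS

The one structural move of this generation.  Given a forced tower `T` and an open neighbourhood `U₀` of the root marked point
`x_0`, the chain of ROOT OPENS `U_0 := U₀`, `U_{i+1} := π_i⁻¹(U_i)` carries the marked points (`x_{i+1} ↦ x_i`), and restricting
EVERY letter of `T` to it — stages `U_i`, marked ideals `𝓘_i|U_i`, centres `C_i|U_i` (the reduced point again), blow-ups
`π_i ∣_ U_i` (Görtz–Wedhorn I, Prop. 13.91: the blow-up square restricted over an open of the base), BGMW transforms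
(restriction
commutes with the transform, `MarkedIdeal.transform_comap_of_isOpenImmersion`) — is again a FORCED TOWER,
`towerRestrict T hN U₀ h0`,
with the same base field, the same weight, the same (empty) boundary, the same local rings at the marked points (so the same
`ThreefoldTower` letter) and an `IsBase` root.  Every tower law of the tree (`NoTower n P` for a class `P` of LOCAL
letters) thereby
becomes a law about the GERM of the tower at its marked points: hypotheses that hold only near `x_0` (here: «`V(𝓘_0)` has
codimension ≥ 2») may be assumed globally. -/

/-- **the chain of root opens** `U_0 = U₀`, `U_{i+1} = π_i⁻¹ U_i` of an open `U₀` of the root stage. -/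
def rootOpens (T : ForcedTower) (U₀ : (T.St 0).Opens) : (i : ℕ) → (T.St i).Opens
  | 0 => U₀
  | i + 1 => T.π i ⁻¹ᵁ rootOpens T U₀ i

/-- unfolding. [folklore] -/
theorem rootOpens_zero (T : ForcedTower) (U₀ : (T.St 0).Opens) : rootOpens T U₀ 0 = U₀ := rfl

/-- unfolding. [folklore] -/
theorem rootOpens_succ (T : ForcedTower) (U₀ : (T.St 0).Opens) (i : ℕ) :
    rootOpens T U₀ (i + 1) = T.π i ⁻¹ᵁ rootOpens T U₀ i := rfl

/-- **the marked points lie in the root opens** (`x_{i+1} ↦ x_i`). [folklore] -/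
theorem pt_mem_rootOpens (T : ForcedTower) {U₀ : (T.St 0).Opens} (h0 : T.pt 0 ∈ U₀) : ∀ i, T.pt i ∈ rootOpens T U₀ i
  | 0 => h0
  | i + 1 => by
    show (T.π i).base (T.pt (i + 1)) ∈ rootOpens T U₀ i
    rw [T.pt_map i]
    exact pt_mem_rootOpens T h0 i

/-- membership in the support of a pulled-back ideal sheaf. [folklore] -/
theorem mem_support_comap_iff {V X : Scheme.{0}} (I : X.IdealSheafData) (f : V ⟶ X) (v : V) :
    v ∈ (I.comap f).support ↔ f.base v ∈ I.support := by
  rw [Scheme.IdealSheafData.support_comap]; rfl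

/-- **THE RESTRICTED TOWER `T|U₀`** — stages the root opens `U_i`, marked ideals `𝓘_i|U_i`, marked points `x_i`, centres
`C_i|U_i`, blow-ups `π_i ∣_ U_i`.  Needs only local Noetherianity of the stages (automatic over an `IsBase` root,
`tower_isLocallyNoetherian_isRegular`). -/
def towerRestrict (T : ForcedTower) (hN : ∀ i, IsLocallyNoetherian (T.St i)) (U₀ : (T.St 0).Opens)
    (h0 : T.pt 0 ∈ U₀) : ForcedTower where
  St i := (rootOpens T U₀ i : Scheme.{0})
  D i := (T.D i).comap (rootOpens T U₀ i).ι
  pt i := ⟨T.pt i, pt_mem_rootOpens T h0 i⟩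
  centre i := (T.centre i).comap (rootOpens T U₀ i).ι
  π i := T.π i ∣_ rootOpens T U₀ i
  isolated i := by
    obtain ⟨hmem, V, hxV, hV⟩ := T.isolated i
    refine ⟨?_, (rootOpens T U₀ i).ι ⁻¹ᵁ V, hxV, ?_⟩
    · rw [MarkedIdeal.support_comap_of_isOpenImmersion]; exact hmem
    · rintro z ⟨hzV, hzS⟩
      rw [MarkedIdeal.support_comap_of_isOpenImmersion] at hzS
      exact Subtype.ext (hV ⟨hzV, hzS⟩)
  isClosed_pt i := by
    convert (T.isClosed_pt i).preimage (rootOpens T U₀ i).ι.continuous using 1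
    exact Set.ext fun z => Subtype.ext_iff.trans Iff.rfl
  centre_support i :=
    Set.ext fun z => (mem_support_comap_iff (T.centre i) (rootOpens T U₀ i).ι z).trans
      ((Set.ext_iff.mp (T.centre_support i) z.val).trans
        (Subtype.ext_iff (a1 := z) (a2 := ⟨T.pt i, pt_mem_rootOpens T h0 i⟩)).symm)
  centre_regular i := by
    haveI := hN i
    exact Scheme.IsRegular.subscheme_comap_of_isOpenImmersion (rootOpens T U₀ i).ι (T.centre_regular i)
  isBlowup i := IsBlowup.morphismRestrict (T.π i) (rootOpens T U₀ i) (T.isBlowup i)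
  transform_eq i := by
    haveI := hN i
    haveI := hN (i + 1)
    rw [T.transform_eq i]
    exact MarkedIdeal.transform_comap_of_isOpenImmersion (rootOpens T U₀ i).ι (T.π i ⁻¹ᵁ rootOpens T U₀ i).ι
      (morphismRestrict_ι (T.π i) (rootOpens T U₀ i)).symm (T.centre i) (T.D i)
  pt_map i := Subtype.ext ((morphismRestrict_base_coe (T.π i) (rootOpens T U₀ i) _).trans (T.pt_map i))

variable (T : ForcedTower) (hN : ∀ i, IsLocallyNoetherian (T.St i)) (U₀ : (T.St 0).Opens) (h0 : T.pt 0 ∈ U₀)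

/-- unfolding: the stages of the restricted tower. [folklore] -/
theorem towerRestrict_St (i : ℕ) : (towerRestrict T hN U₀ h0).St i = (rootOpens T U₀ i : Scheme.{0}) := rfl

/-- unfolding: the marked ideals of the restricted tower. [folklore] -/
theorem towerRestrict_D (i : ℕ) : (towerRestrict T hN U₀ h0).D i = (T.D i).comap (rootOpens T U₀ i).ι := rfl

/-- unfolding: the marked points of the restricted tower. [folklore] -/
theorem towerRestrict_pt_val (i : ℕ) : ((towerRestrict T hN U₀ h0).pt i).val = T.pt i := rfl

/-- unfolding: the centres of the restricted tower. [folklore] -/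
theorem towerRestrict_centre (i : ℕ) :
    (towerRestrict T hN U₀ h0).centre i = (T.centre i).comap (rootOpens T U₀ i).ι := rfl

/-- unfolding: the blow-ups of the restricted tower. [folklore] -/
theorem towerRestrict_π (i : ℕ) : (towerRestrict T hN U₀ h0).π i = T.π i ∣_ rootOpens T U₀ i := rfl

/-- **the support of the restricted marked ideal is the trace of the support.** [folklore] -/
theorem mem_support_towerRestrict_ideal_iff (i : ℕ) (z : (towerRestrict T hN U₀ h0).St i) :
    z ∈ (((towerRestrict T hN U₀ h0).D i).ideal).support ↔ z.val ∈ ((T.D i).ideal).support :=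
  mem_support_comap_iff _ _ _

/-- **INHERITED LETTER `IsBase`**: the root of the restricted tower is again of the base class (`U₀ ↪ Y → Spec k` separated,
locally of finite type, quasi-compact; `U₀` regular of dimension ≤ 4). [folklore] -/
theorem towerRestrict_isBase (g : T.St 0 ⟶ Spec (.of k)) (hB : IsBase (T.St 0) g) :
    IsBase ((towerRestrict T hN U₀ h0).St 0) (U₀.ι ≫ g) := by
  haveI := hN 0
  haveI : IsSeparated g := hB.isSeparated
  haveI : LocallyOfFiniteType g := hB.locallyOfFiniteType
  haveI : QuasiCompact g := hB.quasiCompact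
  have h1 : IsSeparated (U₀.ι ≫ g) := inferInstance
  have h2 : LocallyOfFiniteType (U₀.ι ≫ g) := inferInstance
  have h3 : QuasiCompact (U₀.ι ≫ g) := inferInstance
  have h4 : Scheme.IsRegular (U₀ : Scheme.{0}) := Scheme.IsRegular.of_isOpenImmersion U₀.ι hB.isRegular
  have h5 : topologicalKrullDim (U₀ : Scheme.{0}) ≤ 4 :=
    (U₀.ι.isOpenEmbedding.isInducing.topologicalKrullDim_le).trans hB.dim_le
  exact ⟨h1, h2, h3, h4, h5⟩

/-- **INHERITED LETTER `IsDatum`**: same weight, orders still bounded by the weight. [folklore] -/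
theorem towerRestrict_isDatum {n : ℕ} (hD : IsDatum n (T.D 0)) : IsDatum n ((towerRestrict T hN U₀ h0).D 0) := by
  refine ⟨hD.1, fun y => ?_⟩
  show idealOrder (((T.D 0).ideal).comap U₀.ι) y ≤ _
  rw [idealOrder_comap_of_isOpenImmersion]
  exact hD.2 _

/-- **INHERITED LETTER «empty boundary»**. [folklore] -/
theorem towerRestrict_boundary (hE : (T.D 0).boundary = []) : ((towerRestrict T hN U₀ h0).D 0).boundary = [] := by
  show ((T.D 0).boundary.map _) = []
  rw [hE]; rfl

/-- **the marked local rings are unchanged**: `dim 𝒪_{U_i, x_i} = dim 𝒪_{X_i, x_i}`. [folklore] -/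
theorem towerRestrict_ringKrullDim_stalk (i : ℕ) :
    ringKrullDim (((towerRestrict T hN U₀ h0).St i).presheaf.stalk ((towerRestrict T hN U₀ h0).pt i)) =
      ringKrullDim ((T.St i).presheaf.stalk (T.pt i)) := by
  rw [ringKrullDim_stalk_eq_coheight, ringKrullDim_stalk_eq_coheight,
    ← @coheight_eq_of_isOpenImmersion _ _ ((towerRestrict T hN U₀ h0).pt i) (rootOpens T U₀ i).ι
      (inferInstanceAs (IsOpenImmersion (rootOpens T U₀ i).ι))]
  rfl

/-- **INHERITED LETTER `ThreefoldTower`**. [folklore] -/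
theorem towerRestrict_threefoldTower (h3 : ThreefoldTower T) : ThreefoldTower (towerRestrict T hN U₀ h0) := by
  intro i
  unfold DimThreeAt DimFourAt
  rw [towerRestrict_ringKrullDim_stalk]
  exact h3 i

end Restrict

section Persistence

variable {k : Type} [Field k]

/-! ## §106 (g34 · NEW · KERNEL) THE PERSISTENCE KERNEL: THE EXCEPTIONAL DIVISOR IS NEVER A COMPONENT

The exceptional divisor `E_i = π_i⁻¹(x_i)` of a forced tower is NEVER a component of `V(𝓘_{i+1})`: the weight-`n` controlled
transform of an ideal of order EXACTLY `n` at the (closed, regular) centre does not vanish at the generic point of `E_i`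
(`IsBlowup.genericPoint_exceptional_not_mem_support_controlledTransform`, Enc. Math. Sci. 35, VI.3.2); hence every
codimension-one point of `V(𝓘_{i+1})` lies off `E_i`, where `π_i` is a local isomorphism preserving coheights — the divisorial
components of `V(𝓘_{i+1})` are the strict transforms of those of `V(𝓘_i)`
(`IsBlowup.one_lt_coheight_of_mem_support_controlledTransform`).  By induction on the stage: «`V(𝓘_0)` of codimension ≥ 2»
PERSISTS along the whole tower — the letter `CurveLikeTower` of LAW C is decided AT THE ROOT. -/

/-- **THE PERSISTENCE KERNEL (PROVED; every `p`, every field, every weight):** if the support of the root marked ideal has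
codimension ≥ 2 at each of its points, then so does the support of EVERY marked ideal of the tower — `CurveLikeTower T`.
[folklore] -/
theorem curveLikeTower_of_root (T : ForcedTower) (g : T.St 0 ⟶ Spec (.of k)) (hB : IsBase (T.St 0) g) {n : ℕ}
    (hD : IsDatum n (T.D 0)) (hroot : ∀ z ∈ ((T.D 0).ideal).support, 1 < Order.coheight z) : CurveLikeTower T := by
  intro i
  induction i with
  | zero => exact hroot
  | succ i ih =>
    haveI := (tower_isLocallyNoetherian_isRegular T g hB i).1
    haveI := (tower_isLocallyNoetherian_isRegular T g hB (i + 1)).1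
    intro z hz
    rw [tower_ideal_succ_eq_controlledTransform T hD i] at hz
    have hreg : Scheme.IsRegular (vanishingIdeal ⟨{T.pt i}, T.isClosed_pt i⟩).subscheme := by
      rw [← tower_centre_eq_vanishingIdeal T i]; exact T.centre_regular i
    exact IsBlowup.one_lt_coheight_of_mem_support_controlledTransform (tower_isRegular T g hB i) hreg
      (tower_isBlowup_vanishingIdeal T i)
      (fun y hy => by rw [Set.mem_singleton_iff.mp hy]; exact tower_idealOrder_pt_eq T g hB hD i) ih hz

end Persistence

section DivisorialSteps

variable {k : Type} [Field k]

/-! ## §107 (g34 · NEW · KERNEL) STEP A — A DIVISORIAL COMPONENT THROUGH THE MARKED POINT IS A DIVISORIAL FACTOR;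
STEP B — AN ISOLATING ROOT OPEN

STEP A (`divisorialTower_of_coheight_eq_one`).  At a marked point `x = x_m` the local ring `R = 𝒪_{X_m,x}` is regular, hence a
UFD; a codimension-one point `ζ ∈ V(𝓘_m)` with `ζ ⤳ x` has height-one prime `𝔭_ζ = (p) ⊂ R`, and `ζ ∈ V(𝓘_m)` reads
`(𝓘_m)_x ⊆ 𝔭_ζ = (p)` (`mem_support_iff_stalkIdeal_le_primeOfSpecializes`).  With `H := 𝓘(cl ζ)` (the prime divisor ideal
sheaf, `primeDivisorIdeal ζ`, stalk `(p)` at `x`) and `K := (𝓘_m : H)` (the ideal-sheaf colon, stalk `((𝓘_m)_x : p)`):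
`(𝓘_m)_x = p · ((𝓘_m)_x : p) = H_x · K_x` — a stalk factorization `FactorAt T m a b H K` with `a = ord_x p ≥ 1` and `H_x`
principal: `DivisorialTower T` (g33 §100).  Contrapositive: along a NON-divisorial tower no codimension-one point of any
`V(𝓘_m)` generizes to `x_m`.

STEP B (`exists_rootOpens_one_lt_coheight`).  On an integral Noetherian open `U₁ ∋ x_0` (`exists_opens_isIntegral`) the
codimension-one points of `V(𝓘_0|U₁)` are FINITE in number (`finite_divisorialPoints`: minimal primes of a non-zero ideal on a
Noetherian integral scheme); by Step A none of them generizes to `x_0`, so `x_0` lies off the closed union `Z'` of their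
closures, and on `U₀ := U₁ ∖ Z'` every point of `V(𝓘_0)` has coheight ≠ 0 (the generic point is not in the support of a
non-zero ideal) and ≠ 1: `V(𝓘_0|U₀)` has codimension ≥ 2. -/

/-- an ideal contained between an ideal of finite order and `⊤` has an order that is a natural number: if
`I_x ⊆ J_x` and `ord_x I = n < ∞` then `ord_x J = b` for some `b : ℕ` (with `b ≤ n`). [folklore] -/
theorem exists_nat_idealOrder_eq_of_stalkIdeal_le {X : Scheme.{0}} {I J : X.IdealSheafData} {x : X} {n : ℕ}
    (hI : idealOrder I x = (n : ℕ∞)) (hle : stalkIdeal I x ≤ stalkIdeal J x) : ∃ b : ℕ, idealOrder J x = (b : ℕ∞) := by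
  have hJ : idealOrder J x ≤ (n : ℕ∞) := by
    rw [← hI]
    refine ENat.forall_natCast_le_iff_le.mp fun c hc => ?_
    rw [le_idealOrder_iff] at hc ⊢
    exact hle.trans hc
  have hne : idealOrder J x ≠ ⊤ := by
    intro h; rw [h, top_le_iff] at hJ; exact ENat.coe_ne_top n hJ
  obtain ⟨b, hb⟩ := ENat.ne_top_iff_exists.mp hne
  exact ⟨b, hb.symm⟩

end DivisorialSteps

end Summit.ResolutionOfSingularities.ResolutionOfSingularities.Theorems.HugValuationCut
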